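import Summits.PneNP.PneNP.Theorems.ReslinSizeFromWidthPCDegreeExpandingCNF
import Literature.Computability.MetaComplexity.RandomCNFPolynomialCalculusDegree
import HarnessLib

/-!
# PneNP / ReslinSizeFromWidth — the PC rail for RANDOM `k`-CNFs, every `k ≥ 3` (unconditional, whp)

Helper file for the INPUT side of crux `ResLinSizeFromWidth` (stmt-PneNP-18932).  The PC rail
for expanding CNFs (`ReslinSizeFromWidthPCDegreeExpandingCNF.lean`) turns boundary expansion of
the clause scopes into Res(⊕) rank, clause-space, tree-like-size and quadratic dag-like-size
bounds, through Alekhnovich–Razborov's PC/`𝔽₂` degree theorem.  Its module docstring listed as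
missing "that random `k`-CNF of constant density is such an expander w.h.p.".  The Literature
file `RandomCNFPolynomialCalculusDegree.lean` (rung seat, gen 13) supplies exactly this:
`randomKCNF_coverExpander_ge` — the clause scopes of `φ ∼ F_k(n, Δn)` form a
`(⌊κn⌋, (2k+1)/4)`-cover expander except with probability `≤ 32aB⁴/n`, hence (on the support,
where every clause is a `k`-clause) a `(⌊κn⌋, 1/2)`-boundary expander.  Plugging in:

* **`randomKCNF_resLin_rail`** — for every `k ≥ 3` and natural density `Δ ≥ 1` there is
  `δ = δ(k, Δ) > 0` such that with probability `→ 1` over `φ ∼ F_k(n, Δn)`, for every integer `D`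
  with `k + 1 ≤ D ≤ δn`: every Res(⊕) refutation (semantic weakening) of `φ` has a line of rank
  `≥ D`, every TREE-LIKE one has `≥ 2^(D-k-1)` lines, every refutation `π` satisfies
  `2 + (D-1)D ≤ 2|π| + k(k+1)` (quadratic law), and every configuration-style refutation has
  clause space `≥ D + 1 - k`;
* **`randomKCNF_unsat_resLin_rail`** — the same together with UNSATISFIABILITY of `φ` above the
  Chvátal–Szemerédi density `Δ ≥ 0.7 · 2^k`.

For `k = 3` the rank statement is the tree's `randomThreeCnf_resLinRank_linear` (gen 1, directly
from cover expansion, density `c ≥ 6`); here it comes through PC degree, for EVERY `k ≥ 3` and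
every density, as in print ("degree lower bounds for random 3-CNFs [AR01] … imply exponential
lower bounds on the size of tree-like Res(⊕) proofs", Efremenko–Garlík–Itsykson 2024 §1.1.1;
Part–Tzameret 2021 Cor. for random `k`-CNF; Garlík–Kołodziejczyk 2018).  New in tree only:
the quadratic dag-like bound and the clause-space bound for random `k`-CNF, `k ≥ 4`.

Honest framing: corollaries by composition; constants are the crude ones of the tree's counting
lemmas.  Not claimed: anything superquadratic for dag-like Res(⊕) (the crux itself).

References: A. A. Razborov, 8ECM 2023, Thm 6.9; M. Alekhnovich, A. Razborov, FOCS 2001;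
K. Efremenko, M. Garlík, D. Itsykson, STOC 2024, §1.1.1; F. Part, I. Tzameret, Comput. Complexity
2021; S. Gryaznov, S. Ovcharov, A. Riazanov, ACM ToCT 2024, Cor. 1.
-/

noncomputable section

namespace Summit.PneNP.PneNP.Theorems

-- `Summit.PneNP.PneNP` repeats a path component by design (summit = sub-problem); silence the linter.
set_option linter.dupNamespace false

namespace ResLinPC

open Finset Filter Literature.Computability.Complexity Literature.Computability.MetaComplexity
open Summit.PneNP.PneNP.Theorems.PolyCalc
open scoped Topology ENNReal

universe u

/-- The rail event at size `n`, rate `δ` and clause width `k`: for every integer `D` with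
`k + 1 ≤ D ≤ δn`, every Res(⊕) refutation of `φ` has rank-width `≥ D`, tree-like ones have
`≥ 2^(D-k-1)` lines, all satisfy the quadratic law `2 + (D-1)D ≤ 2|π| + k(k+1)`, and
configuration-style refutations have clause space `≥ D + 1 - k`. [this file] -/
def railEvent (k : ℕ) (δ : ℝ) (n : ℕ) : Set (CNF ℕ) :=
  {φ | ∀ D : ℕ, k + 1 ≤ D → (D : ℝ) ≤ δ * n →
    (∀ π : List ResLinLine, IsResLinRefutation φ π →
      D ≤ resLinWidth π ∧
      ((∀ i : ℕ, (π.map fun l => l.premises.count i).sum ≤ 1) → 2 ^ (D - k - 1) ≤ π.length) ∧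
      2 + (D - 1) * D ≤ 2 * π.length + k * (k + 1)) ∧
    ∀ ϖ : List (Finset LinClause), IsResLinSpaceRefutation φ ϖ → D + 1 - k ≤ resLinClauseSpace ϖ}

/-- The two scope families of the tree agree (`PC.clauseScope` of `ExpandingCNFDegree.lean` is
`cnfScopes` of `ScopeExpansion.lean`). [bookkeeping] -/
private theorem clauseScope_eq_cnfScopes' (φ : CNF ℕ) : PC.clauseScope φ = cnfScopes φ := by
  funext i
  simp only [PC.clauseScope, cnfScopes, Literature.Computability.MetaComplexity.clauseScope,
    List.get_eq_getElem, Fin.getElem_fin]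

/-- **Deterministic core.** A CNF all of whose clauses are `k`-clauses (`kClauses k n`) whose
scopes form an `(N, (2k+1)/4)`-cover expander with `N ≥ 2` lies in the rail event for every
`D ≤ N/4` (cover `(k + 1/2)/2` ⇒ boundary `1/2` ⇒ PC/`𝔽₂` degree `> N/4` ⇒ the rail).
[Alekhnovich–Razborov 2001 + the tree's rail] -/
theorem rail_of_isCoverExpander {k n N : ℕ} {φ : CNF ℕ} (hφ : ∀ C ∈ φ, C ∈ kClauses k n)
    (hN2 : 2 ≤ N) (hcov : IsCoverExpander (cnfScopes φ) N ((2 * (k : ℝ) + 1) / 4)) {D : ℕ}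
    (hkD : k + 1 ≤ D) (hD : (D : ℝ) ≤ N / 4) :
    (∀ π : List ResLinLine, IsResLinRefutation φ π →
      D ≤ resLinWidth π ∧
      ((∀ i : ℕ, (π.map fun l => l.premises.count i).sum ≤ 1) → 2 ^ (D - k - 1) ≤ π.length) ∧
      2 + (D - 1) * D ≤ 2 * π.length + k * (k + 1)) ∧
    ∀ ϖ : List (Finset LinClause), IsResLinSpaceRefutation φ ϖ →
      D + 1 - k ≤ resLinClauseSpace ϖ := by
  classical
  have hwidth : φ.IsWidthLE k := fun C hC => (length_of_mem_kClauses (hφ C hC)).le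
  have hcard : ∀ i, (cnfScopes φ i).card ≤ k := fun i =>
    (card_clauseScope_le _).trans (hwidth _ (List.getElem_mem _))
  have hcov' : IsCoverExpander (cnfScopes φ) N (((k : ℝ) + 1 / 2) / 2) := by
    have : (2 * (k : ℝ) + 1) / 4 = ((k : ℝ) + 1 / 2) / 2 := by ring
    rw [← this]; exact hcov
  have hbd : IsBoundaryExpander (PC.clauseScope φ) N (1 / 2) := by
    rw [clauseScope_eq_cnfScopes']
    exact hcov'.isBoundaryExpander hcard
  have hs : (2 : ℝ) ≤ N := by exact_mod_cast hN2
  have hδ : (0 : ℝ) < 1 / 2 := by norm_num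
  have hD' : (D : ℝ) ≤ 1 / 2 * N / 2 := by linarith
  have hkD' : k ≤ D := by omega
  refine ⟨fun π hπ => ⟨resLinWidth_expandingCNF φ hs hδ hbd hwidth hkD' hD' hπ,
    fun htree => treeLike_length_expandingCNF φ hs hδ hbd hwidth hkD' hD' hπ htree,
    quadratic_length_expandingCNF φ hs hδ hbd hwidth hkD hD' hπ⟩,
    fun ϖ hϖ => clauseSpace_expandingCNF φ hs hδ hbd hwidth hkD hD' hϖ⟩

/-- If `μ n ≤ 1`, `β n → 0` and eventually `1 - β n ≤ μ n`, then `μ n → 1`. [bookkeeping] -/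
private theorem tendsto_one_of_eventually_ge' {μ : ℕ → ℝ≥0∞} {β : ℕ → ℝ} (hμ : ∀ n, μ n ≤ 1)
    (hβ : Tendsto β atTop (𝓝 0)) (h : ∀ᶠ n in atTop, 1 - ENNReal.ofReal (β n) ≤ μ n) :
    Tendsto μ atTop (𝓝 1) := by
  have hβE : Tendsto (fun n => ENNReal.ofReal (β n)) atTop (𝓝 0) := by
    have := ENNReal.tendsto_ofReal hβ
    rwa [ENNReal.ofReal_zero] at this
  have hlow : Tendsto (fun n => 1 - ENNReal.ofReal (β n)) atTop (𝓝 1) := by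
    have := ENNReal.Tendsto.sub (tendsto_const_nhds (x := (1 : ℝ≥0∞))) hβE
      (Or.inl ENNReal.one_ne_top)
    rwa [tsub_zero] at this
  refine tendsto_of_tendsto_of_tendsto_of_le_of_le' hlow tendsto_const_nhds h
    (Eventually.of_forall fun n => (hμ n))

/-- An event of a `PMF` has probability at most one. [bookkeeping] -/
private theorem pmf_toOuterMeasure_le_one' {α : Type*} (p : PMF α) (E : Set α) :
    p.toOuterMeasure E ≤ 1 :=
  (MeasureTheory.measure_mono (Set.subset_univ _)).trans_eq
    ((PMF.toOuterMeasure_apply_eq_one_iff _ _).2 (Set.subset_univ _))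

/-- **The PC rail for random `k`-CNFs, every `k ≥ 3`, every density `Δ ≥ 1`.**  There is
`δ = δ(k, Δ) > 0` (`δ = κ/5`, `κ = 1/(a(2B)^4)`, `a = (2k+1)/4`, `B = e^{1+a} Δ a`) such that
`Pr_{φ ∼ F_k(n, Δn)}[railEvent k δ n] → 1`: with high probability, for every `k + 1 ≤ D ≤ δn`,
every Res(⊕) refutation of `φ` has a line of rank `≥ D`, tree-like ones have `≥ 2^(D-k-1)`
lines, all obey `2 + (D-1)D ≤ 2|π| + k(k+1)`, and configuration-style ones have clause space
`≥ D + 1 - k`. [Alekhnovich–Razborov 2001 (degree); Efremenko–Garlík–Itsykson 2024 §1.1.1 and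
Part–Tzameret 2021 (tree-like); Gryaznov–Ovcharov–Riazanov 2024 Cor. 1 (space); the tree's
quadratic law] -/
theorem randomKCNF_resLin_rail (k Δ : ℕ) (hk : 3 ≤ k) (hΔ : 1 ≤ Δ) :
    ∃ δ : ℝ, 0 < δ ∧ Tendsto (fun n : ℕ => (randomKCNF k n (Δ * n)).toOuterMeasure
      (railEvent k δ n)) atTop (𝓝 1) := by
  -- constants
  set a : ℝ := (2 * k + 1) / 4 with ha
  set B : ℝ := Real.exp (1 + a) * Δ * a with hB
  set κ : ℝ := 1 / (a * (2 * B) ^ 4) with hκ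
  have hk3 : (3 : ℝ) ≤ k := by exact_mod_cast hk
  have hΔ1 : (1 : ℝ) ≤ Δ := by exact_mod_cast hΔ
  have ha74 : (7 : ℝ) / 4 ≤ a := by rw [ha]; linarith
  have hapos : 0 < a := by linarith
  have hBpos : 0 < B := by rw [hB]; positivity
  have hκpos : 0 < κ := by rw [hκ]; positivity
  refine ⟨κ / 5, by positivity, ?_⟩
  refine tendsto_one_of_eventually_ge' (β := fun n => 32 * a * B ^ 4 / n)
    (fun n => pmf_toOuterMeasure_le_one' _ _)
    (by simpa using tendsto_const_div_atTop_nhds_zero_nat (32 * a * B ^ 4)) ?_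
  refine eventually_atTop.2 ⟨⌈(k + 5) / κ⌉₊, fun n hn => ?_⟩
  have hκn : ((k : ℝ) + 5) ≤ κ * n := by
    have h1 : ((k : ℝ) + 5) / κ ≤ n := (Nat.le_ceil _).trans (by exact_mod_cast hn)
    rw [div_le_iff₀ hκpos] at h1
    linarith
  set N : ℕ := ⌊κ * n⌋₊ with hNdef
  have hNle : (N : ℝ) ≤ κ * n := Nat.floor_le (by positivity)
  have hNge : κ * n - 1 < N := Nat.sub_one_lt_floor _
  have hk0 : (0 : ℝ) ≤ k := Nat.cast_nonneg k
  have hN2 : 2 ≤ N := by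
    have : (2 : ℝ) < N := by linarith
    exact_mod_cast this.le
  have hkn : k ≤ n := by
    have hκ1 : κ ≤ 1 := by
      rw [hκ, div_le_one (by positivity)]
      have h2B : (1 : ℝ) ≤ 2 * B := by
        rw [hB]
        have h1 : (1 : ℝ) ≤ Real.exp (1 + a) := Real.one_le_exp (by linarith)
        nlinarith [mul_le_mul h1 hΔ1 (by norm_num) (by linarith : (0 : ℝ) ≤ Real.exp (1 + a))]
      have h2B4 : (1 : ℝ) ≤ (2 * B) ^ 4 := one_le_pow₀ h2B
      nlinarith
    have : (k : ℝ) ≤ n := by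
      nlinarith [mul_nonneg (sub_nonneg.2 hκ1) (Nat.cast_nonneg (α := ℝ) n)]
    exact_mod_cast this
  have haN : a * N ≤ n / (2 * B) ^ 4 := by
    calc a * N ≤ a * (κ * n) := mul_le_mul_of_nonneg_left hNle hapos.le
      _ = n / (2 * B) ^ 4 := by rw [hκ]; field_simp
  have hmain := randomKCNF_coverExpander_ge hk hΔ hkn ha hB haN
  refine hmain.trans (PMF.toOuterMeasure_mono _ ?_)
  rintro φ ⟨hcov, hsupp⟩ D hkD hD
  have hall := forall_mem_of_mem_support_randomKCNF hsupp
  have hcov' : IsCoverExpander (cnfScopes φ) N ((2 * (k : ℝ) + 1) / 4) := by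
    rw [← ha]; exact hcov
  refine rail_of_isCoverExpander hall hN2 hcov' hkD ?_
  have : κ / 5 * n ≤ (κ * n - 1) / 4 := by linarith
  linarith

/-- **The rail with unsatisfiability**, above the Chvátal–Szemerédi density `Δ ≥ 0.7 · 2^k`:
`Pr_{φ ∼ F_k(n, Δn)}[φ unsatisfiable ∧ railEvent k δ n] → 1` for some `δ = δ(k, Δ) > 0`.
[Chvátal–Szemerédi 1988; Alekhnovich–Razborov 2001; the tree's rail] -/
theorem randomKCNF_unsat_resLin_rail (k Δ : ℕ) (hk : 3 ≤ k) (hΔ : (0.7 : ℝ) * 2 ^ k ≤ Δ) :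
    ∃ δ : ℝ, 0 < δ ∧ Tendsto (fun n : ℕ => (randomKCNF k n (Δ * n)).toOuterMeasure
      ({φ | ¬ φ.Satisfiable} ∩ railEvent k δ n)) atTop (𝓝 1) := by
  -- constants
  set a : ℝ := (2 * k + 1) / 4 with ha
  set B : ℝ := Real.exp (1 + a) * Δ * a with hB
  set κ : ℝ := 1 / (a * (2 * B) ^ 4) with hκ
  set r : ℝ := 2 * (1 - (1 / 2 : ℝ) ^ k) ^ Δ with hr
  have hk3 : (3 : ℝ) ≤ k := by exact_mod_cast hk
  have hΔ1' : 1 ≤ Δ := by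
    have h1 : (1 : ℝ) ≤ 2 ^ k := one_le_pow₀ (by norm_num)
    have h2 : (0 : ℝ) < Δ := by linarith
    exact_mod_cast h2
  have hΔ1 : (1 : ℝ) ≤ Δ := by exact_mod_cast hΔ1'
  have ha74 : (7 : ℝ) / 4 ≤ a := by rw [ha]; linarith
  have hapos : 0 < a := by linarith
  have hBpos : 0 < B := by rw [hB]; positivity
  have hκpos : 0 < κ := by rw [hκ]; positivity
  have hr0 : 0 ≤ r := by
    rw [hr]
    have : (0 : ℝ) ≤ 1 - (1 / 2) ^ k := by
      rw [sub_nonneg]; exact pow_le_one₀ (by norm_num) (by norm_num)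
    positivity
  have hr1 : r < 1 := two_mul_pow_lt_one_of_density hΔ
  refine ⟨κ / 5, by positivity, ?_⟩
  refine tendsto_one_of_eventually_ge' (β := fun n => r ^ n + 32 * a * B ^ 4 / n)
    (fun n => pmf_toOuterMeasure_le_one' _ _) ?_ ?_
  · have h1 := tendsto_pow_atTop_nhds_zero_of_lt_one hr0 hr1
    have h2 := tendsto_const_div_atTop_nhds_zero_nat (32 * a * B ^ 4)
    simpa using h1.add h2
  refine eventually_atTop.2 ⟨⌈(k + 5) / κ⌉₊, fun n hn => ?_⟩
  have hκn : ((k : ℝ) + 5) ≤ κ * n := by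
    have h1 : ((k : ℝ) + 5) / κ ≤ n := (Nat.le_ceil _).trans (by exact_mod_cast hn)
    rw [div_le_iff₀ hκpos] at h1
    linarith
  set N : ℕ := ⌊κ * n⌋₊ with hNdef
  have hNle : (N : ℝ) ≤ κ * n := Nat.floor_le (by positivity)
  have hNge : κ * n - 1 < N := Nat.sub_one_lt_floor _
  have hk0 : (0 : ℝ) ≤ k := Nat.cast_nonneg k
  have hN2 : 2 ≤ N := by
    have : (2 : ℝ) < N := by linarith
    exact_mod_cast this.le
  have hkn : k ≤ n := by
    have hκ1 : κ ≤ 1 := by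
      rw [hκ, div_le_one (by positivity)]
      have h2B : (1 : ℝ) ≤ 2 * B := by
        rw [hB]
        have h1 : (1 : ℝ) ≤ Real.exp (1 + a) := Real.one_le_exp (by linarith)
        nlinarith [mul_le_mul h1 hΔ1 (by norm_num) (by linarith : (0 : ℝ) ≤ Real.exp (1 + a))]
      have h2B4 : (1 : ℝ) ≤ (2 * B) ^ 4 := one_le_pow₀ h2B
      nlinarith
    have : (k : ℝ) ≤ n := by
      nlinarith [mul_nonneg (sub_nonneg.2 hκ1) (Nat.cast_nonneg (α := ℝ) n)]
    exact_mod_cast this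
  have haN : a * N ≤ n / (2 * B) ^ 4 := by
    calc a * N ≤ a * (κ * n) := mul_le_mul_of_nonneg_left hNle hapos.le
      _ = n / (2 * B) ^ 4 := by rw [hκ]; field_simp
  have hmain := randomKCNF_unsat_coverExpander_ge hk hΔ hkn ha hB haN
  refine hmain.trans (PMF.toOuterMeasure_mono _ ?_)
  rintro φ ⟨⟨hns, hcov⟩, hsupp⟩
  refine ⟨hns, fun D hkD hD => ?_⟩
  have hall := forall_mem_of_mem_support_randomKCNF hsupp
  have hcov' : IsCoverExpander (cnfScopes φ) N ((2 * (k : ℝ) + 1) / 4) := by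
    rw [← ha]; exact hcov
  refine rail_of_isCoverExpander hall hN2 hcov' hkD ?_
  have : κ / 5 * n ≤ (κ * n - 1) / 4 := by linarith
  linarith

end ResLinPC

end Summit.PneNP.PneNP.Theorems
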